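import Literature.GroupTheory.CombinatorialGroupTheory.AmalgamConjugation
import Mathlib.GroupTheory.SpecificGroups.Cyclic.Basic
import HarnessLib

/-!
# Conjugacy normal form in an amalgam; centralizers of elliptic elements; torsion

Topic `Literature/GroupTheory/CombinatorialGroupTheory`; theorems only, continuing
`AmalgamReducedWords.lean` / `AmalgamConjugation.lean` (letter lists in Mathlib's
`Monoid.PushoutI φ`; reduced = alternating factors, no letter in the amalgamated subgroup; value
`ℓπ[φ] l`).  Throughout, the amalgamated subgroup is assumed **malnormal** in each factor:
`g ∉ φ i(H)` and `g · φ i(c) · g⁻¹ ∈ φ i(H)` force `c = 1` (Magnus–Karrass–Solitar §4.2;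
Karrass–Solitar, Trans. AMS 150 (1970)).

* `exists_conj_normalForm` — **every element is conjugate to a cyclically reduced one**
  (MKS Thm. 4.6, first part): to an element of the base group, or to a single letter not conjugate
  (in its factor) into the base group, or to the value of a reduced word of length `≥ 2` whose end
  letters lie in different factors;
* `centralizer_base_le_range`, `centralizer_of_le_range` — under malnormality, **the centralizer of
  a non-trivial base element lies in the base group, and the centralizer of a letter not conjugate
  into the base group lies in its factor** (MKS §4.2, Cor. 4.5 / Karrass–Solitar);
  `isCyclic_centralizer_base`, `isCyclic_centralizer_of` — hence these centralizers are cyclic when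
  centralizers in `H` resp. in the factors are;
* `eq_one_of_pow_eq_one` — if `H` and the factors are torsion free then so is the amalgam;
  `isCyclic_centralizer_of_conj` — cyclicity of centralizers is a conjugacy invariant.

## References

* W. Magnus, A. Karrass, D. Solitar, *Combinatorial Group Theory*, Interscience (1966), §4.2,
  Thm. 4.6, Cor. 4.4.5, Cor. 4.5. [MagnusKarrassSolitar1966]
* R. C. Lyndon, P. E. Schupp, *Combinatorial Group Theory*, Springer (1977); Classics in
  Mathematics (2001), Ch. IV Thm. 2.8. [LyndonSchupp2001]
-/

namespace Literature.GroupTheory.CombinatorialGroupTheory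

namespace Amalgam

open Monoid Monoid.PushoutI

variable {ι : Type*} {G : ι → Type*} [∀ i, Group (G i)] {H : Type*} [Group H]
  {φ : ∀ i, H →* G i}

/-- The value in `PushoutI φ` of a letter list. -/
local notation3 "ℓπ[" φ "] " l:max =>
  List.prod (List.map (fun x => Monoid.PushoutI.of (φ := φ) (Sigma.fst x) (Sigma.snd x)) l)

/-- The formal inverse of a letter list. -/
local notation3 "ℓinv " l:max =>
  List.reverse (List.map (fun x => Sigma.mk (Sigma.fst x) (Sigma.snd x)⁻¹) l)

/-! ### Cyclicity of centralizers is a conjugacy invariant -/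

/-- `Z(p x p⁻¹) = p Z(x) p⁻¹`. [cite: MagnusKarrassSolitar1966, §4.2] -/
theorem centralizer_conj_eq_map {M : Type*} [Group M] (x p : M) :
    Subgroup.centralizer ({p * x * p⁻¹} : Set M) =
      (Subgroup.centralizer ({x} : Set M)).map (MulAut.conj p).toMonoidHom := by
  ext g
  rw [Subgroup.mem_centralizer_singleton_iff, Subgroup.mem_map]
  constructor
  · intro h
    refine ⟨p⁻¹ * g * p, ?_, by simp [MulAut.conj_apply, mul_assoc]⟩
    rw [Subgroup.mem_centralizer_singleton_iff]
    calc p⁻¹ * g * p * x = p⁻¹ * (g * (p * x * p⁻¹)) * p := by group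
      _ = x * (p⁻¹ * g * p) := by rw [h]; group
  · rintro ⟨g', hg', rfl⟩
    rw [Subgroup.mem_centralizer_singleton_iff] at hg'
    simp only [MulEquiv.coe_toMonoidHom, MulAut.conj_apply]
    calc p * g' * p⁻¹ * (p * x * p⁻¹) = p * (g' * x) * p⁻¹ := by group
      _ = p * x * p⁻¹ * (p * g' * p⁻¹) := by rw [hg']; group

/-- **Cyclicity of the centralizer is a conjugacy invariant.** [cite: MagnusKarrassSolitar1966, §4.2] -/
theorem isCyclic_centralizer_of_conj {M : Type*} [Group M] {x : M} (p : M)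
    (h : IsCyclic (Subgroup.centralizer ({p * x * p⁻¹} : Set M))) :
    IsCyclic (Subgroup.centralizer ({x} : Set M)) := by
  rw [centralizer_conj_eq_map] at h
  haveI := h
  let e := ((Subgroup.centralizer ({x} : Set M)).equivMapOfInjective (MulAut.conj p).toMonoidHom
    (MulAut.conj p).injective).symm
  exact isCyclic_of_surjective e e.surjective

/-! ### Every element is conjugate to a cyclically reduced element -/

/-- **Conjugacy normal form (MKS Thm. 4.6, first part).**  Every element `x` of the amalgam has a
conjugate `p x p⁻¹` which is (a) in the base group, or (b) a single letter `g ∈ G i ∖ φ i(H)` that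
is not conjugate within `G i` into `φ i(H)`, or (c) the value of a reduced word of length `≥ 2`
whose first and last letters lie in different factors. [cite: MagnusKarrassSolitar1966, §4.2 Thm. 4.6] -/
theorem exists_conj_normalForm (hφ : ∀ i, Function.Injective (φ i)) (x : PushoutI φ) :
    ∃ p : PushoutI φ,
      (∃ c : H, p * x * p⁻¹ = base φ c) ∨
      (∃ (i : ι) (g : G i), (∀ a : G i, a * g * a⁻¹ ∉ (φ i).range) ∧ p * x * p⁻¹ = of i g) ∨
      (∃ w : List (Σ i, G i), w.IsChain (fun a b => a.1 ≠ b.1) ∧ (∀ y ∈ w, y.2 ∉ (φ y.1).range) ∧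
        2 ≤ w.length ∧ (∀ a ∈ w.getLast?, ∀ b ∈ w.head?, a.1 ≠ b.1) ∧ p * x * p⁻¹ = ℓπ[φ] w) := by
  -- induction on the length of a reduced word
  suffices key : ∀ (n : ℕ) (c₀ : H) (l : List (Σ i, G i)), l.length ≤ n →
      l.IsChain (fun a b => a.1 ≠ b.1) → (∀ y ∈ l, y.2 ∉ (φ y.1).range) →
      ∃ p : PushoutI φ,
        (∃ c : H, p * (base φ c₀ * ℓπ[φ] l) * p⁻¹ = base φ c) ∨
        (∃ (i : ι) (g : G i), (∀ a : G i, a * g * a⁻¹ ∉ (φ i).range) ∧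
          p * (base φ c₀ * ℓπ[φ] l) * p⁻¹ = of i g) ∨
        (∃ w : List (Σ i, G i), w.IsChain (fun a b => a.1 ≠ b.1) ∧
          (∀ y ∈ w, y.2 ∉ (φ y.1).range) ∧ 2 ≤ w.length ∧
          (∀ a ∈ w.getLast?, ∀ b ∈ w.head?, a.1 ≠ b.1) ∧ p * (base φ c₀ * ℓπ[φ] l) * p⁻¹ = ℓπ[φ] w) by
    obtain ⟨c₀, l, hc, hr, rfl⟩ := exists_reduced_eq hφ x
    exact key l.length c₀ l le_rfl hc hr
  intro n
  induction n with
  | zero =>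
    intro c₀ l hl _ _
    rw [Nat.le_zero, List.length_eq_zero_iff] at hl
    subst hl
    exact ⟨1, Or.inl ⟨c₀, by simp⟩⟩
  | succ n ih =>
    intro c₀ l hl hc hr
    rcases l with _ | ⟨⟨i, a⟩, u⟩
    · exact ⟨1, Or.inl ⟨c₀, by simp⟩⟩
    -- absorb `c₀` into the first letter
    have hval : base φ c₀ * ℓπ[φ] (⟨i, a⟩ :: u) = ℓπ[φ] (⟨i, φ i c₀ * a⟩ :: u) :=
      base_mul_lprod_cons c₀ i a u
    have ha : φ i c₀ * a ∉ (φ i).range := base_mul_not_mem_range (hr _ List.mem_cons_self) c₀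
    rw [hval]
    rcases List.eq_nil_or_concat u with rfl | ⟨u', ⟨j, b⟩, hu⟩
    · -- a single letter
      by_cases hconj : ∃ d : G i, d * (φ i c₀ * a) * d⁻¹ ∈ (φ i).range
      · obtain ⟨d, ⟨c, hc'⟩⟩ := hconj
        refine ⟨of i d, Or.inl ⟨c, ?_⟩⟩
        rw [lprod_singleton, ← map_inv, ← map_mul, ← map_mul, ← hc', of_apply_eq_base]
      · push Not at hconj
        exact ⟨1, Or.inr (Or.inl ⟨i, φ i c₀ * a, hconj, by rw [lprod_singleton]; simp⟩)⟩
    · rw [List.concat_eq_append] at hu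
      subst hu
      by_cases hij : j = i
      · -- equal end factors: conjugate by the last letter and recurse
        subst hij
        generalize ha' : φ j c₀ * a = a' at ha
        have hy : of j b * ℓπ[φ] (⟨j, a'⟩ :: (u' ++ [⟨j, b⟩])) * (of j b)⁻¹ =
            of j (b * a') * ℓπ[φ] u' := by
          rw [lprod_cons, lprod_append, lprod_singleton, map_mul]; group
        have hu'c : u'.IsChain (fun a b => a.1 ≠ b.1) := (hc.tail).infix ⟨[], [⟨j, b⟩], by simp⟩
        have hu'r : ∀ y ∈ u', y.2 ∉ (φ y.1).range := fun y hy =>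
          hr y (List.mem_cons_of_mem _ (List.mem_append_left _ hy))
        by_cases hba : b * a' ∈ (φ j).range
        · obtain ⟨c, hc'⟩ := hba
          -- `y = base c · ℓπ u'`, shorter by two letters
          obtain ⟨p, hp⟩ := ih c u' (by simp at hl; omega) hu'c hu'r
          refine ⟨p * of j b, ?_⟩
          have : p * of j b * ℓπ[φ] (⟨j, a'⟩ :: (u' ++ [⟨j, b⟩])) * (p * of j b)⁻¹ =
              p * (base φ c * ℓπ[φ] u') * p⁻¹ := by
            rw [← of_apply_eq_base φ j, hc', ← hy]; group
          rw [this]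
          exact hp
        · -- `y = ℓπ ((b a') :: u')`, shorter by one letter
          have hu'0 : ∀ y ∈ u'.head?, j ≠ y.1 := fun y hy =>
            hc.rel_head? (by
              rw [List.head?_append_of_ne_nil _ (by rintro rfl; simp at hy)]
              exact hy)
          obtain ⟨p, hp⟩ := ih 1 (⟨j, b * a'⟩ :: u') (by simp at hl ⊢; omega)
            (isChain_cons_of_head hu'c hu'0) (by
              intro y hy
              rw [List.mem_cons] at hy
              rcases hy with rfl | hy
              · exact hba
              · exact hu'r y hy)
          refine ⟨p * of j b, ?_⟩
          have : p * of j b * ℓπ[φ] (⟨j, a'⟩ :: (u' ++ [⟨j, b⟩])) * (p * of j b)⁻¹ =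
              p * (base φ 1 * ℓπ[φ] (⟨j, b * a'⟩ :: u')) * p⁻¹ := by
            rw [map_one, one_mul, lprod_cons (⟨j, b * a'⟩ : Σ i, G i), ← hy]; group
          rw [this]
          exact hp
      · -- different end factors: already cyclically reduced
        refine ⟨1, Or.inr (Or.inr ⟨⟨i, φ i c₀ * a⟩ :: (u' ++ [⟨j, b⟩]), ?_, ?_, by simp, ?_, by simp⟩)⟩
        · exact isChain_cons_of_head hc.tail fun y hy => hc.rel_head? hy
        · intro y hy
          rw [List.mem_cons] at hy
          rcases hy with rfl | hy
          · exact ha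
          · exact hr y (List.mem_cons_of_mem _ hy)
        · intro x hx y hy
          rw [List.head?_cons, Option.mem_some_iff] at hy
          rw [← List.cons_append, List.getLast?_concat, Option.mem_some_iff] at hx
          subst hx hy
          exact hij

/-! ### Torsion -/

/-- **A torsion-free amalgam**: if `H` and all factors are torsion free, `y ^ m = 1` with `m ≠ 0`
forces `y = 1` (elements of finite order are conjugate into a factor, MKS Cor. 4.4.5).
[cite: MagnusKarrassSolitar1966, §4.2 Cor. 4.4.5] -/
theorem eq_one_of_pow_eq_one (hφ : ∀ i, Function.Injective (φ i)) [IsMulTorsionFree H]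
    [∀ i, IsMulTorsionFree (G i)] {y : PushoutI φ} {m : ℕ} (hm : m ≠ 0) (h : y ^ m = 1) :
    y = 1 := by
  obtain ⟨p, hp⟩ := exists_conj_normalForm hφ y
  have hpm : (p * y * p⁻¹) ^ m = 1 := by rw [conj_pow, h, mul_one, mul_inv_cancel]
  suffices p * y * p⁻¹ = 1 by
    rwa [mul_inv_eq_one, mul_eq_left] at this
  rcases hp with ⟨c, hc⟩ | ⟨i, g, -, hg⟩ | ⟨w, hwc, hwr, h2, hcr, hw⟩
  · rw [hc] at hpm ⊢
    rw [← map_pow] at hpm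
    have h1 : c ^ m = 1 := base_injective hφ (by rwa [map_one])
    rw [(pow_eq_one_iff_left hm).1 h1, map_one]
  · rw [hg] at hpm ⊢
    rw [← map_pow] at hpm
    have h1 : g ^ m = 1 := of_injective hφ i (by rwa [map_one])
    rw [(pow_eq_one_iff_left hm).1 h1, map_one]
  · rw [hw] at hpm
    exact absurd hpm (pow_lprod_ne_one hφ hwc hwr hcr (by rintro rfl; simp at h2) hm)

/-! ### Centralizers of elliptic elements under malnormality -/

/-- **The centralizer of a non-trivial base element lies in the base group** (malnormal
amalgamated subgroup). [cite: MagnusKarrassSolitar1966, §4.2 Cor. 4.5] -/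
theorem centralizer_base_le_range (hφ : ∀ i, Function.Injective (φ i))
    (hmal : ∀ (i : ι) (g : G i), g ∉ (φ i).range → ∀ c : H, g * φ i c * g⁻¹ ∈ (φ i).range → c = 1)
    {c : H} (hc : c ≠ 1) :
    Subgroup.centralizer ({base φ c} : Set (PushoutI φ)) ≤ (base φ).range := by
  intro h hh
  rw [Subgroup.mem_centralizer_singleton_iff] at hh
  obtain ⟨c₁, l, hlc, hlr, rfl⟩ := exists_reduced_eq hφ h
  rcases List.eq_nil_or_concat l with rfl | ⟨l₀, ⟨j, b⟩, hl⟩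
  · exact ⟨c₁, by simp⟩
  · exfalso
    rw [List.concat_eq_append] at hl
    subst hl
    -- `ℓπ l · base c · (ℓπ l)⁻¹ = base (c₁⁻¹ c c₁)`
    have key : ℓπ[φ] (l₀ ++ [⟨j, b⟩]) * base φ c * (ℓπ[φ] (l₀ ++ [⟨j, b⟩]))⁻¹ = base φ (c₁⁻¹ * c * c₁) := by
      rw [map_mul, map_mul, map_inv]
      calc ℓπ[φ] (l₀ ++ [⟨j, b⟩]) * base φ c * (ℓπ[φ] (l₀ ++ [⟨j, b⟩]))⁻¹
          = (base φ c₁)⁻¹ * (base φ c₁ * ℓπ[φ] (l₀ ++ [⟨j, b⟩]) * base φ c) *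
              (ℓπ[φ] (l₀ ++ [⟨j, b⟩]))⁻¹ := by group
        _ = (base φ c₁)⁻¹ * (base φ c * (base φ c₁ * ℓπ[φ] (l₀ ++ [⟨j, b⟩]))) *
              (ℓπ[φ] (l₀ ++ [⟨j, b⟩]))⁻¹ := by rw [hh]
        _ = (base φ c₁)⁻¹ * base φ c * base φ c₁ := by group
    by_cases hb : b * φ j c * b⁻¹ ∈ (φ j).range
    · exact hc (hmal j b (hlr ⟨j, b⟩ (by simp)) c hb)
    · -- the word `l₀ (b φc b⁻¹) l₀⁻¹` is reduced with value in the base group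
      have hval : ℓπ[φ] (l₀ ++ [Sigma.mk j (b * φ j c * b⁻¹)] ++ ℓinv l₀) = base φ (c₁⁻¹ * c * c₁) := by
        rw [← key, lprod_append, lprod_append, lprod_inv, lprod_append, lprod_singleton,
          lprod_singleton, map_mul, map_mul, map_inv, of_apply_eq_base]
        group
      refine absurd (eq_nil_of_lprod_mem_range hφ
        (l := l₀ ++ [Sigma.mk j (b * φ j c * b⁻¹)] ++ ℓinv l₀) ?_ ?_ (hval ▸ ⟨_, rfl⟩)) (by simp)
      · have h0 : (l₀ ++ [Sigma.mk j (b * φ j c * b⁻¹)]).IsChain (fun a b => a.1 ≠ b.1) :=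
          isChain_append_cons (hlc.infix ⟨[], [⟨j, b⟩], by simp⟩) (List.IsChain.singleton _)
            (fun d hd => rel_of_isChain_concat hlc d hd)
        refine isChain_concat_append h0 ((isChain_inv_iff l₀).2 (hlc.infix ⟨[], [⟨j, b⟩], by simp⟩))
          fun d hd => ?_
        rw [head?_inv] at hd
        cases h1 : l₀.getLast? with
        | none => rw [h1] at hd; simp at hd
        | some e =>
          rw [h1, Option.map_some, Option.mem_some_iff] at hd
          subst hd
          exact fun h => rel_of_isChain_concat hlc e h1 h.symm
      · intro y hy
        rw [List.mem_append, List.mem_append, List.mem_singleton] at hy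
        rcases hy with (hy | rfl) | hy
        · exact hlr y (List.mem_append_left _ hy)
        · exact hb
        · exact (offBase_inv_iff l₀).2 (fun z hz => hlr z (List.mem_append_left _ hz)) y hy

/-- **The centralizer of a non-trivial base element is cyclic** when centralizers of non-trivial
elements of `H` are. [cite: MagnusKarrassSolitar1966, §4.2 Cor. 4.5] -/
theorem isCyclic_centralizer_base (hφ : ∀ i, Function.Injective (φ i))
    (hmal : ∀ (i : ι) (g : G i), g ∉ (φ i).range → ∀ c : H, g * φ i c * g⁻¹ ∈ (φ i).range → c = 1)
    (hZH : ∀ c : H, c ≠ 1 → IsCyclic (Subgroup.centralizer ({c} : Set H)))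
    {c : H} (hc : c ≠ 1) : IsCyclic (Subgroup.centralizer ({base φ c} : Set (PushoutI φ))) := by
  have hle := centralizer_base_le_range hφ hmal hc
  have heq : Subgroup.centralizer ({base φ c} : Set (PushoutI φ)) =
      (Subgroup.centralizer ({c} : Set H)).map (base φ) := by
    refine le_antisymm (fun g hg => ?_) fun g hg => ?_
    · obtain ⟨c', rfl⟩ := hle hg
      refine ⟨c', ?_, rfl⟩
      rw [Subgroup.mem_centralizer_singleton_iff] at hg
      rw [SetLike.mem_coe, Subgroup.mem_centralizer_singleton_iff]
      exact base_injective hφ (by simpa [map_mul] using hg)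
    · obtain ⟨c', hc', rfl⟩ := hg
      rw [SetLike.mem_coe, Subgroup.mem_centralizer_singleton_iff] at hc'
      rw [Subgroup.mem_centralizer_singleton_iff, ← map_mul, hc', map_mul]
  rw [heq]
  haveI := hZH c hc
  let e := (Subgroup.centralizer ({c} : Set H)).equivMapOfInjective (base φ) (base_injective hφ)
  exact isCyclic_of_surjective e e.surjective

/-- **The centralizer of a letter `g ∈ G i` not conjugate (in `G i`) into the base group lies in
`G i`** (malnormal amalgamated subgroup). [cite: MagnusKarrassSolitar1966, §4.2 Cor. 4.5] -/
theorem centralizer_of_le_range (hφ : ∀ i, Function.Injective (φ i)) {i : ι} {g : G i}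
    (hg : ∀ a : G i, a * g * a⁻¹ ∉ (φ i).range) :
    Subgroup.centralizer ({of (φ := φ) i g} : Set (PushoutI φ)) ≤ (of (φ := φ) i).range := by
  intro h hh
  rw [Subgroup.mem_centralizer_singleton_iff] at hh
  have hg1 : g ∉ (φ i).range := by simpa using hg 1
  obtain ⟨c₁, l, hlc, hlr, rfl⟩ := exists_reduced_eq hφ h
  -- `ℓπ l` conjugates `of g` to `of g'`, `g' = φc₁⁻¹ g φc₁ ∉ φ i(H)`
  have hg' : (φ i c₁)⁻¹ * g * φ i c₁ ∉ (φ i).range := by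
    simpa using mul_not_mem_range hg1 c₁⁻¹ c₁
  have hh' : ℓπ[φ] l * of i g * (ℓπ[φ] l)⁻¹ = of i ((φ i c₁)⁻¹ * g * φ i c₁) := by
    rw [map_mul, map_mul, map_inv, of_apply_eq_base]
    calc ℓπ[φ] l * of i g * (ℓπ[φ] l)⁻¹
        = (base φ c₁)⁻¹ * (base φ c₁ * ℓπ[φ] l * of i g) * (ℓπ[φ] l)⁻¹ := by group
      _ = (base φ c₁)⁻¹ * (of i g * (base φ c₁ * ℓπ[φ] l)) * (ℓπ[φ] l)⁻¹ := by rw [hh]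
      _ = (base φ c₁)⁻¹ * of i g * base φ c₁ := by group
  -- the one-letter word for the conjugate
  have hsc : ([Sigma.mk i ((φ i c₁)⁻¹ * g * φ i c₁)] : List (Σ i, G i)).IsChain
      (fun a b => a.1 ≠ b.1) := List.IsChain.singleton _
  have hsr : ∀ y ∈ ([Sigma.mk i ((φ i c₁)⁻¹ * g * φ i c₁)] : List (Σ i, G i)),
      y.2 ∉ (φ y.1).range := by
    intro y hy; rw [List.mem_singleton] at hy; subst hy; exact hg'
  rcases List.eq_nil_or_concat l with rfl | ⟨l₀, ⟨j, b⟩, hl⟩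
  · exact ⟨φ i c₁, by simp [of_apply_eq_base]⟩
  · rw [List.concat_eq_append] at hl
    subst hl
    have hl₀c : l₀.IsChain (fun a b => a.1 ≠ b.1) := hlc.infix ⟨[], [⟨j, b⟩], by simp⟩
    have hl₀r : ∀ y ∈ l₀, y.2 ∉ (φ y.1).range := fun z hz => hlr z (List.mem_append_left _ hz)
    by_cases hji : j = i
    · subst hji
      -- the word `l₀ (b g b⁻¹) l₀⁻¹` is reduced with a one-letter value, so `l₀ = []`
      have hval : ℓπ[φ] (l₀ ++ [Sigma.mk j (b * g * b⁻¹)] ++ ℓinv l₀) =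
          ℓπ[φ] [Sigma.mk j ((φ j c₁)⁻¹ * g * φ j c₁)] := by
        rw [lprod_singleton, ← hh', lprod_append, lprod_append, lprod_inv, lprod_append,
          lprod_singleton, lprod_singleton, map_mul, map_mul, map_inv]
        group
      have hLc : (l₀ ++ [Sigma.mk j (b * g * b⁻¹)] ++ ℓinv l₀).IsChain (fun a b => a.1 ≠ b.1) := by
        have h0 : (l₀ ++ [Sigma.mk j (b * g * b⁻¹)]).IsChain (fun a b => a.1 ≠ b.1) :=
          isChain_append_cons hl₀c (List.IsChain.singleton _) (fun d hd => rel_of_isChain_concat hlc d hd)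
        refine isChain_concat_append h0 ((isChain_inv_iff l₀).2 hl₀c) fun d hd => ?_
        rw [head?_inv] at hd
        cases h1 : l₀.getLast? with
        | none => rw [h1] at hd; simp at hd
        | some e =>
          rw [h1, Option.map_some, Option.mem_some_iff] at hd
          subst hd
          exact fun h => rel_of_isChain_concat hlc e h1 h.symm
      have hLr : ∀ y ∈ l₀ ++ [Sigma.mk j (b * g * b⁻¹)] ++ ℓinv l₀, y.2 ∉ (φ y.1).range := by
        intro y hy
        rw [List.mem_append, List.mem_append, List.mem_singleton] at hy
        rcases hy with (hy | rfl) | hy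
        · exact hl₀r y hy
        · exact hg b
        · exact (offBase_inv_iff l₀).2 hl₀r y hy
      have hlen := length_eq_of_lprod_eq hφ hLc hLr hsc hsr 1 (by rw [map_one, one_mul]; exact hval)
      obtain rfl : l₀ = [] := by rcases l₀ with _ | ⟨d, l₁⟩ <;> [rfl; simp at hlen]
      refine ⟨φ j c₁ * b, ?_⟩
      rw [List.nil_append, lprod_singleton, map_mul, of_apply_eq_base]
    · -- last letter in another factor: the word `l g l⁻¹` is reduced of length `2|l| + 1 > 1`
      exfalso
      have hval : ℓπ[φ] (l₀ ++ [Sigma.mk j b] ++ [Sigma.mk i g] ++ ℓinv (l₀ ++ [Sigma.mk j b])) =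
          ℓπ[φ] [Sigma.mk i ((φ i c₁)⁻¹ * g * φ i c₁)] := by
        rw [lprod_singleton, ← hh', lprod_conj_shape, lprod_singleton]
      have hLc : (l₀ ++ [Sigma.mk j b] ++ [Sigma.mk i g] ++ ℓinv (l₀ ++ [Sigma.mk j b])).IsChain
          (fun a b => a.1 ≠ b.1) := by
        refine isChain_concat_append (P := l₀ ++ [Sigma.mk j b]) ?_ ((isChain_inv_iff _).2 hlc)
          fun d hd => ?_
        · exact isChain_append_cons hlc (List.IsChain.singleton _) fun d hd => by
            rw [List.getLast?_concat, Option.mem_some_iff] at hd; subst hd; exact hji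
        · rw [head?_inv, List.getLast?_concat, Option.map_some, Option.mem_some_iff] at hd
          subst hd
          exact fun h => hji h.symm
      have hLr : ∀ y ∈ l₀ ++ [Sigma.mk j b] ++ [Sigma.mk i g] ++ ℓinv (l₀ ++ [Sigma.mk j b]),
          y.2 ∉ (φ y.1).range := by
        intro y hy
        rw [List.mem_append, List.mem_append, List.mem_singleton] at hy
        rcases hy with (hy | rfl) | hy
        · exact hlr y hy
        · exact hg1
        · exact (offBase_inv_iff _).2 hlr y hy
      have hlen := length_eq_of_lprod_eq hφ hLc hLr hsc hsr 1 (by rw [map_one, one_mul]; exact hval)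
      simp at hlen
      omega

/-- **The centralizer of such a letter is cyclic** when centralizers of non-trivial elements of the
factors are. [cite: MagnusKarrassSolitar1966, §4.2 Cor. 4.5] -/
theorem isCyclic_centralizer_of (hφ : ∀ i, Function.Injective (φ i))
    (hZ : ∀ (i : ι) (g : G i), g ≠ 1 → IsCyclic (Subgroup.centralizer ({g} : Set (G i))))
    {i : ι} {g : G i} (hg : ∀ a : G i, a * g * a⁻¹ ∉ (φ i).range) :
    IsCyclic (Subgroup.centralizer ({of (φ := φ) i g} : Set (PushoutI φ))) := by
  have hle := centralizer_of_le_range hφ hg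
  have hg1 : g ≠ 1 := by
    rintro rfl
    exact hg 1 (by simp)
  have heq : Subgroup.centralizer ({of (φ := φ) i g} : Set (PushoutI φ)) =
      (Subgroup.centralizer ({g} : Set (G i))).map (of (φ := φ) i) := by
    refine le_antisymm (fun x hx => ?_) fun x hx => ?_
    · obtain ⟨a, rfl⟩ := hle hx
      refine ⟨a, ?_, rfl⟩
      rw [Subgroup.mem_centralizer_singleton_iff] at hx
      rw [SetLike.mem_coe, Subgroup.mem_centralizer_singleton_iff]
      exact of_injective hφ i (by simpa [map_mul] using hx)
    · obtain ⟨a, ha, rfl⟩ := hx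
      rw [SetLike.mem_coe, Subgroup.mem_centralizer_singleton_iff] at ha
      rw [Subgroup.mem_centralizer_singleton_iff, ← map_mul, ha, map_mul]
  rw [heq]
  haveI := hZ i g hg1
  let e := (Subgroup.centralizer ({g} : Set (G i))).equivMapOfInjective (of (φ := φ) i)
    (of_injective hφ i)
  exact isCyclic_of_surjective e e.surjective

end Amalgam

end Literature.GroupTheory.CombinatorialGroupTheory
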